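import Mathlib
import HarnessLib

/-!
# K1-B meridian package V — prime factors versus components (route `SignSymmetricPowers`, item
# stmt-HodgeConjecture-19716): an irreducible hypersurface inside a finite union of prime zero sets is one of them

Helper file (`--supports stmt-HodgeConjecture-19716`) for the open stubs GEN / LINK-G of the K1-B line `andre-zariski`:
the pure-algebra step (c)/(iii) of the component count G2 of memo K1B-GEN-STUBPLAN-g23 H2 (= K1B-LINKF-PLAN-g23
§3d(iii)–(iv)) — once the three singular strata `Δ_Π, Δ_L, Δ_pair ⊂ A_M` are known to be zero sets of non-zero
PRIME ideals covering `V(D_M)`, every prime factor `hⱼ` of `D_M = killHom Disc` generates one of these primes, and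
non-associated factors generate different ones.

* `exists_prime_mem_of_isPrime` — a non-zero prime ideal of the UFD `ℂ[a]` contains a prime element;
* `eq_span_singleton_of_le` — a non-zero prime ideal inside `(h)`, `h` irreducible, equals `(h)` (height one);
* **`exists_span_singleton_eq_of_zeroLocus_subset`** — `h` irreducible, `P₁…P_r` non-zero primes,
  `V(h) ⊆ ⋃ V(Pᵢ)` (complex points, Mathlib `MvPolynomial.zeroLocus`) ⇒ `(h) = Pᵢ` for some `i` (Nullstellensatz
  `MvPolynomial.vanishingIdeal_zeroLocus_eq_radical`, `Ideal.IsPrime.prod_le`);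
* `associated_of_span_singleton_eq`.

What G2 still needs on top (NOT here): the strata are irreducible (their vanishing ideals are prime) and non-zero,
and the pair stratum's factor is smooth at two-node forms.

Sorry-free; axioms standard; no definition, no named fact.

## References

* [Hartshorne1977] R. Hartshorne, Algebraic Geometry, I Prop. 1.13, I Ex. 1.1.3, I Thm. 1.3A (Nullstellensatz).
-/

noncomputable section

set_option linter.dupNamespace false

open MvPolynomial

namespace Summit.HodgeConjecture.HodgeConjecture.Theorems.SignSymmetricPowersMeridianPrimes

variable {σ : Type*}

/-- A non-zero prime ideal of the UFD `ℂ[a]` contains a prime ELEMENT. [folklore] -/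
theorem exists_prime_mem_of_isPrime {P : Ideal (MvPolynomial σ ℂ)} (hP : P.IsPrime) (hP0 : P ≠ ⊥) :
    ∃ q ∈ P, Prime q := by
  classical
  obtain ⟨p, hpP, hp0⟩ := Submodule.exists_mem_ne_zero_of_ne_bot hP0
  obtain ⟨u, hu⟩ := UniqueFactorizationMonoid.factors_prod hp0
  have hmem : (UniqueFactorizationMonoid.factors p).prod * (u : MvPolynomial σ ℂ) ∈ P := by rw [hu]; exact hpP
  rcases hP.mem_or_mem hmem with hprod | hunit
  · obtain ⟨q, hq, hqP⟩ := (hP.multiset_prod_mem_iff_exists_mem _).1 hprod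
    exact ⟨q, hqP, UniqueFactorizationMonoid.prime_of_factor q hq⟩
  · exact absurd (P.eq_top_of_isUnit_mem hunit u.isUnit) hP.ne_top

/-- A non-zero prime ideal contained in the principal ideal of an irreducible element equals it (height one).
[folklore] -/
theorem eq_span_singleton_of_le {P : Ideal (MvPolynomial σ ℂ)} (hP : P.IsPrime) (hP0 : P ≠ ⊥)
    {h : MvPolynomial σ ℂ} (hirr : Irreducible h) (hle : P ≤ Ideal.span {h}) : P = Ideal.span {h} := by
  refine le_antisymm hle ?_
  obtain ⟨q, hqP, hq⟩ := exists_prime_mem_of_isPrime hP hP0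
  have hdvd : h ∣ q := Ideal.mem_span_singleton.1 (hle hqP)
  have hassoc : Associated h q := by
    rcases hq.irreducible.dvd_iff.1 hdvd with hunit | hassoc
    · exact absurd hunit hirr.not_isUnit
    · exact hassoc.symm
  rw [Ideal.span_singleton_le_iff_mem]
  obtain ⟨u, hu⟩ := hassoc.symm
  rw [← hu]
  exact P.mul_mem_right _ hqP

/-- **An irreducible hypersurface inside a finite union of prime zero sets is one of them.**  Let `h ∈ ℂ[a]`
be irreducible and `P₁, …, P_r` non-zero prime ideals with `V(h) ⊆ V(P₁) ∪ ⋯ ∪ V(P_r)` (complex points).  Then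
`(h) = Pᵢ` for some `i` (Nullstellensatz: `∏ Pᵢ ⊆ I(⋃ V(Pᵢ)) ⊆ I(V(h)) = (h)`, prime avoidance, height one).
This is step (c)/(iii) of the component count G2 for the restricted discriminant (memo K1B-GEN-STUBPLAN-g23 H2):
the prime factors of `D_M` are among the prime ideals of the three singular strata.
[cite: Hartshorne1977, I Prop. 1.13 and I Ex. 1.1.3 (Nullstellensatz, irreducible hypersurfaces)] -/
theorem exists_span_singleton_eq_of_zeroLocus_subset [Finite σ] {r : ℕ} {h : MvPolynomial σ ℂ} (hirr : Irreducible h)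
    (P : Fin r → Ideal (MvPolynomial σ ℂ)) (hP : ∀ i, (P i).IsPrime) (hP0 : ∀ i, P i ≠ ⊥)
    (hsub : zeroLocus ℂ (Ideal.span {h}) ⊆ ⋃ i, zeroLocus ℂ (P i)) :
    ∃ i, Ideal.span {h} = P i := by
  classical
  have hprime : (Ideal.span {h} : Ideal (MvPolynomial σ ℂ)).IsPrime :=
    (Ideal.span_singleton_prime hirr.ne_zero).2 hirr.prime
  -- `∏ Pᵢ ≤ (h)`
  have hprod : (Finset.univ : Finset (Fin r)).prod P ≤ Ideal.span {h} := by
    intro f hf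
    have hrad : f ∈ (Ideal.span {h} : Ideal (MvPolynomial σ ℂ)).radical := by
      rw [← vanishingIdeal_zeroLocus_eq_radical (K := ℂ), mem_vanishingIdeal_iff]
      intro x hx
      obtain ⟨i, hi⟩ := Set.mem_iUnion.1 (hsub hx)
      have hfi : f ∈ P i := Ideal.prod_le_inf hf |> (Finset.inf_le (Finset.mem_univ i) : _ ≤ P i)
      exact (mem_zeroLocus_iff.1 hi) f hfi
    rwa [hprime.isRadical.radical] at hrad
  obtain ⟨i, -, hi⟩ := hprime.prod_le.1 hprod
  exact ⟨i, (eq_span_singleton_of_le (hP i) (hP0 i) hirr hi).symm⟩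

/-- Distinct (non-associated) irreducibles cannot both cut out the same prime: if `(h) = P = (h')` then `h` and
`h'` are associated. [folklore] -/
theorem associated_of_span_singleton_eq {h h' : MvPolynomial σ ℂ} (hh : Ideal.span {h} = Ideal.span {h'}) :
    Associated h h' :=
  Ideal.span_singleton_eq_span_singleton.1 hh

end Summit.HodgeConjecture.HodgeConjecture.Theorems.SignSymmetricPowersMeridianPrimes

end
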